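import Mathlib.Analysis.SpecialFunctions.Pow.Real
import Mathlib.Analysis.SpecialFunctions.Trigonometric.Basic
import Mathlib.Analysis.Complex.ExponentialBounds
import Mathlib.NumberTheory.PrimeCounting
import HarnessLib

/-!
# [IUTchIV] Theorem 1.10 (Log-volume Estimates for Θ-Pilot Objects): the numbers of the statement,
# `C_Θ` exactly as printed, the proof data, and Steps (i)–(iii) of the proof

Mochizuki, *Inter-universal Teichmüller theory IV*, RIMS manuscript (Apr. 2020; = PRIMS **57**
(2021)), Theorem 1.10, statement pp. 22–23, proof pp. 23–31. TAKES NO SIDE on the disputed step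
([IUTchIII] Cor. 3.12 is a HYPOTHESIS, `Thm110Numerics.Cor312`, never asserted). Companion file:
`Theorem110.lean` (Step (viii), the assembly of `C_Θ`, and the displayed inequalities).

The proof of Theorem 1.10 has two kinds of content: (a) LOG-VOLUME content — Steps (iv)–(vii) bound,
prime by prime of `ℚ`, the procession-normalized mono-analytic log-volume of the holomorphic hull of the
union of possible images of a Θ-pilot object, using Props. 1.2–1.5 and 1.7 (the averaging part of this is
`Theorem110LocalBounds.lean`); and (b) REAL ARITHMETIC — Steps (i)–(iii) and (viii) turn those bounds,
the Prop. 1.3-based inequalities between log-differents/log-conductors of `F_mod ⊆ F_tpd ⊆ F ⊆ K`, and the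
prime number theorem (Prop. 1.6) into the printed constant `C_Θ` and the displayed inequality. This file
and its companion PROVE (b) in full, taking as NAMED hypotheses (the fields of
`Thm110Numerics.ProofData`, each quoting the printed intermediate inequality it stands for and the printed
source of that inequality) exactly the outputs of (a) and of Prop. 1.3 / Prop. 1.8 that (b) consumes.

Here: the (E6)-type numerical facts of Step (i) (p. 24); `Thm110Numerics` (the numbers of the STATEMENT,
with `d*_mod`, `e*_mod`, `l*_mod`, `|log(q)| = (1/2l)·log(q)`, the braces and `C_Θ` VERBATIM from p. 23,
the two displayed conclusions, and the hypothesis `Cor312`); `ProofData`; Step (ii) (p. 24: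
`log(2^11·3^3·5^2) ≤ 21`, the `46`) and Step (iii) (p. 26: `5 + log(l)`, the `6`, the `52`) PROVED.

Deliberately NOT here (other files / seats): the log-volume computations of Steps (iv)–(vii) (they
DISCHARGE the field `hull_le`); Props. 1.1–1.5; the number fields `F_mod ⊆ F_tpd ⊆ F ⊆ K`, their
differents and Prop. 1.8 (they discharge `F_le`, `K_le`, `tpd_le_F`, `sQ_le`); any judgement on Cor. 3.12.
-/

noncomputable section

namespace Literature.IUT.LogVolume

open Real
open scoped Nat.Prime

/-! ## (E6)-type numerical facts used by the printed proof (Step (i), p. 24) -/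

/-- (E6), p. 24: `log(2) ≤ 1`. [claim: Mochizuki2012, status: disputed] -/
private theorem log_two_le_one : Real.log 2 ≤ 1 := by
  have := Real.log_le_sub_one_of_pos (show (0 : ℝ) < 2 by norm_num); linarith

/-- (E6), p. 24: `log(3) ≤ 2`. [claim: Mochizuki2012, status: disputed] -/
private theorem log_three_le_two : Real.log 3 ≤ 2 := by
  have := Real.log_le_sub_one_of_pos (show (0 : ℝ) < 3 by norm_num); linarith

/-- (E6), p. 24: `log(5) ≤ 2` (since `5 ≤ e²`). [claim: Mochizuki2012, status: disputed] -/
private theorem log_five_le_two : Real.log 5 ≤ 2 := by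
  have he := Real.exp_one_gt_d9
  have h5 : (5 : ℝ) ≤ Real.exp 2 := by
    have : Real.exp 2 = Real.exp 1 * Real.exp 1 := by rw [← Real.exp_add]; norm_num
    rw [this]; nlinarith
  calc Real.log 5 ≤ Real.log (Real.exp 2) := Real.log_le_log (by norm_num) h5
    _ = 2 := Real.log_exp 2

/-- (E6), p. 24: `log(π) ≤ 2` (indeed `π ≤ 4 ≤ e²`). [claim: Mochizuki2012, status: disputed] -/
theorem log_pi_le_two : Real.log Real.pi ≤ 2 := by
  have he := Real.exp_one_gt_d9
  have h4 : Real.pi ≤ Real.exp 2 := by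
    have : Real.exp 2 = Real.exp 1 * Real.exp 1 := by rw [← Real.exp_add]; norm_num
    rw [this]; nlinarith [Real.pi_le_four]
  calc Real.log Real.pi ≤ Real.log (Real.exp 2) := Real.log_le_log Real.pi_pos h4
    _ = 2 := Real.log_exp 2

/-- The printed estimate "`log(l)/l ≤ 1/2`" (Step (ii), p. 24; also "`l ≥ log(l)`", Step (viii), p. 31),
valid for every real `x > 0`: `log(x)/x ≤ 1/2` (`log x = 2·log √x ≤ 2(√x − 1) ≤ x/2`). (The form
`log x ≤ x/2` is already in the tree, in a module of the Weil explicit formula too heavy to import here.)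
[claim: Mochizuki2012, status: disputed] -/
theorem log_div_self_le_half {x : ℝ} (hx : 0 < x) : Real.log x / x ≤ 1 / 2 := by
  have hs : 0 < Real.sqrt x := Real.sqrt_pos.mpr hx
  have h1 : Real.log (Real.sqrt x) ≤ Real.sqrt x - 1 := Real.log_le_sub_one_of_pos hs
  have h2 : Real.log x = 2 * Real.log (Real.sqrt x) := by
    conv_lhs => rw [← Real.sq_sqrt hx.le]
    rw [Real.log_pow]; norm_num
  have h3 : Real.sqrt x * Real.sqrt x = x := Real.mul_self_sqrt hx.le
  rw [div_le_iff₀ hx]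
  nlinarith [sq_nonneg (Real.sqrt x - 2)]

/-- Step (ii), p. 24: `log(2^11·3^3·5^2) ≤ 21` (via (E6): `11·1 + 3·2 + 2·2 = 21`).
[claim: Mochizuki2012, status: disputed] -/
theorem log_two_pow_eleven_mul_le : Real.log (2 ^ 11 * 3 ^ 3 * 5 ^ 2) ≤ 21 := by
  rw [Real.log_mul (by norm_num) (by norm_num), Real.log_mul (by norm_num) (by norm_num),
    Real.log_pow, Real.log_pow, Real.log_pow]
  have := log_two_le_one; have := log_three_le_two; have := log_five_le_two
  push_cast
  linarith

/-- Step (iii), p. 26: `log(2·3·5·l) ≤ 5 + log(l)` (via (E6)). [claim: Mochizuki2012, status: disputed] -/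
theorem log_thirty_mul_le {l : ℝ} (hl : 0 < l) : Real.log (2 * 3 * 5 * l) ≤ 5 + Real.log l := by
  rw [Real.log_mul (by norm_num) hl.ne', Real.log_mul (by norm_num) (by norm_num),
    Real.log_mul (by norm_num) (by norm_num)]
  have := log_two_le_one; have := log_three_le_two; have := log_five_le_two
  linarith

/-! ## The numbers in the statement of Theorem 1.10 -/

/-- The integers and real numbers entering the STATEMENT of [IUTchIV] Theorem 1.10 (pp. 22–23) for
one collection of initial Θ-data `(F̄/F, X_F, l, C_K, 𝕍, 𝕍^bad_mod, ε)` "in the situation of [IUTchIII],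
Corollary 3.12": "`d_mod := [F_mod : ℚ]`, `(1 ≤) e_mod (≤ d_mod)` for the maximal ramification index of
`F_mod` … over `ℚ`", the prime `l` ([IUTchI] Def. 3.1 (c): `l ≥ 5`), "`log(𝔡^{F_tpd})`, `log(𝔣^{F_tpd})`,
`log(𝔡^F)`, `log(𝔣^F) ∈ ℝ_{≥0}`" (normalized degrees of the different and conductor arithmetic divisors,
p. 23), "`log(q) ∈ ℝ_{≥0}`" (degree of the `q`-parameter divisor at `𝕍^bad ≠ ∅`, so `> 0`; "the quantity
`|log(q)| ∈ ℝ_{>0}` … is equal to `(1/2l)·log(q)`", p. 23), `η_prm` (Prop. 1.6), and the real number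
"`−|log(Θ)| ∈ ℝ`" of [IUTchIII] Cor. 3.12. Pure data: no relation between the fields is assumed beyond
the printed signs/ranges. [claim: Mochizuki2012, status: disputed] -/
structure Thm110Numerics where
  /-- the prime `l` of the initial Θ-data -/
  l : ℕ
  /-- `l` is prime ([IUTchI] Def. 3.1 (c)) -/
  prime_l : l.Prime
  /-- `l ≥ 5` ([IUTchI] Def. 3.1 (c)) -/
  five_le_l : 5 ≤ l
  /-- `d_mod = [F_mod : ℚ]` -/
  dmod : ℕ
  /-- `d_mod ≥ 1` -/
  one_le_dmod : 1 ≤ dmod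
  /-- `e_mod`, the maximal ramification index of `F_mod` over `ℚ` -/
  emod : ℕ
  /-- `1 ≤ e_mod` -/
  one_le_emod : 1 ≤ emod
  /-- `e_mod ≤ d_mod` -/
  emod_le_dmod : emod ≤ dmod
  /-- `η_prm`, "the positive real number of Proposition 1.6" -/
  etaPrm : ℝ
  /-- `η_prm > 0` -/
  etaPrm_pos : 0 < etaPrm
  /-- `log(𝔡^{F_tpd}) ∈ ℝ_{≥0}` -/
  logDiffTpd : ℝ
  /-- as printed -/
  logDiffTpd_nonneg : 0 ≤ logDiffTpd
  /-- `log(𝔣^{F_tpd}) ∈ ℝ_{≥0}` -/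
  logCondTpd : ℝ
  /-- as printed -/
  logCondTpd_nonneg : 0 ≤ logCondTpd
  /-- `log(𝔡^F) ∈ ℝ_{≥0}` -/
  logDiffF : ℝ
  /-- as printed -/
  logDiffF_nonneg : 0 ≤ logDiffF
  /-- `log(𝔣^F) ∈ ℝ_{≥0}` -/
  logCondF : ℝ
  /-- as printed -/
  logCondF_nonneg : 0 ≤ logCondF
  /-- `log(q) ∈ ℝ_{≥0}`, in fact `> 0` -/
  logq : ℝ
  /-- `|log(q)| = (1/2l)·log(q) ∈ ℝ_{>0}` -/
  logq_pos : 0 < logq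
  /-- `−|log(Θ)| ∈ ℝ` ([IUTchIII] Cor. 3.12: "it holds that `−|log(Θ)| ∈ ℝ`") -/
  negLogTheta : ℝ

namespace Thm110Numerics

/-- `d*_mod := 2^12·3^3·5·d_mod` (p. 22). [claim: Mochizuki2012, status: disputed] -/
def dstar (X : Thm110Numerics) : ℕ := 2 ^ 12 * 3 ^ 3 * 5 * X.dmod

/-- `e*_mod := 2^12·3^3·5·e_mod (≤ d*_mod)` (p. 22). [claim: Mochizuki2012, status: disputed] -/
def estar (X : Thm110Numerics) : ℕ := 2 ^ 12 * 3 ^ 3 * 5 * X.emod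

/-- `l*_mod := log(e*_mod·l)` (Step (v), p. 28). [claim: Mochizuki2012, status: disputed] -/
def lstar (X : Thm110Numerics) : ℝ := Real.log ((X.estar : ℝ) * X.l)

/-- `|log(q)| := (1/2l)·log(q)` ("the quantity `|log(q)| ∈ ℝ_{>0}` defined in [IUTchIII], Corollary 3.12,
is equal to `(1/2l)·log(q)`", p. 23). [claim: Mochizuki2012, status: disputed] -/
def absLogq (X : Thm110Numerics) : ℝ := X.logq / (2 * (X.l : ℝ))

/-- The braces of the printed `C_Θ` (p. 23):
`{(1 + 12·d_mod/l)·(log(𝔡^{F_tpd}) + log(𝔣^{F_tpd})) + 10·(e*_mod·l + η_prm) − (1/6)·(1 − 12/l²)·log(q)}`.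
[claim: Mochizuki2012, status: disputed] -/
def bracket (X : Thm110Numerics) : ℝ :=
  (1 + 12 * (X.dmod : ℝ) / X.l) * (X.logDiffTpd + X.logCondTpd)
    + 10 * ((X.estar : ℝ) * X.l + X.etaPrm) - 1 / 6 * (1 - 12 / ((X.l : ℝ) ^ 2)) * X.logq

/-- `C_Θ := (l+1)/(4·|log(q)|)·{…} − 1`, VERBATIM from the statement of Theorem 1.10 (p. 23): "Then one
may take the constant “`C_Θ ∈ ℝ`” of [IUTchIII], Corollary 3.12, to be" this number.
[claim: Mochizuki2012, status: disputed] -/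
def CTheta (X : Thm110Numerics) : ℝ := ((X.l : ℝ) + 1) / (4 * X.absLogq) * X.bracket - 1

/-- "One may take the constant `C_Θ` of [IUTchIII], Corollary 3.12, to be" the printed number MEANS: the
hypothesis "`−|log(Θ)| ≤ C_Θ·|log(q)|`" of the last clause of Cor. 3.12 holds for it. This is what Steps
(i)–(viii) of the proof establish (`cThetaAdmissible_of_proofData`). [claim: Mochizuki2012, status: disputed] -/
def CThetaAdmissible (X : Thm110Numerics) : Prop := X.negLogTheta ≤ X.CTheta * X.absLogq

/-- [IUTchIII] Corollary 3.12 for these data, in the form it is applied on p. 23 ("by applying the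
inequality “`C_Θ ≥ −1`” of [IUTchIII], Corollary 3.12"), namely its real-number content
`−|log(q)| ≤ −|log(Θ)|`. HYPOTHESIS (the disputed statement) — never asserted in this file.
[claim: Mochizuki2012, status: disputed] -/
def Cor312 (X : Thm110Numerics) : Prop := -X.absLogq ≤ X.negLogTheta

/-- The first displayed conclusion of Theorem 1.10 (p. 23):
`(1/6)·log(q) ≤ (1 + 20·d_mod/l)·(log(𝔡^{F_tpd}) + log(𝔣^{F_tpd})) + 20·(e*_mod·l + η_prm)`.
[claim: Mochizuki2012, status: disputed] -/
def Display (X : Thm110Numerics) : Prop :=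
  1 / 6 * X.logq ≤ (1 + 20 * (X.dmod : ℝ) / X.l) * (X.logDiffTpd + X.logCondTpd)
    + 20 * ((X.estar : ℝ) * X.l + X.etaPrm)

/-- The second displayed conclusion of Theorem 1.10 (p. 23):
`(1/6)·log(q) ≤ (1 + 20·d_mod/l)·(log(𝔡^F) + log(𝔣^F)) + 20·(e*_mod·l + η_prm)`.
[claim: Mochizuki2012, status: disputed] -/
def DisplayF (X : Thm110Numerics) : Prop :=
  1 / 6 * X.logq ≤ (1 + 20 * (X.dmod : ℝ) / X.l) * (X.logDiffF + X.logCondF)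
    + 20 * ((X.estar : ℝ) * X.l + X.etaPrm)

/-! ### Elementary facts about the data -/

/-- `l ≥ 5` ([IUTchI] Def. 3.1 (c)) as a real inequality. [claim: Mochizuki2012, status: disputed] -/
theorem five_le_l_real (X : Thm110Numerics) : (5 : ℝ) ≤ X.l := by exact_mod_cast X.five_le_l

/-- `e*_mod = 2^12·3^3·5·e_mod ≥ 2^12·3^3·5 = 552960` (p. 22, with `e_mod ≥ 1`; used on p. 31 as
"`e_mod ≥ 1`, `2^12·3·5 ≥ 56`"). [claim: Mochizuki2012, status: disputed] -/
theorem estar_ge (X : Thm110Numerics) : (552960 : ℝ) ≤ X.estar := by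
  have h : 552960 ≤ X.estar := by
    unfold estar; have := X.one_le_emod; nlinarith
  exact_mod_cast h

/-- `|log(q)| > 0`. [claim: Mochizuki2012, status: disputed] -/
theorem absLogq_pos (X : Thm110Numerics) : 0 < X.absLogq := by
  unfold absLogq; have := X.five_le_l_real; have := X.logq_pos; positivity

/-- "[Thus, it follows … from [IUTchI], Definition 3.1, (c), that `l ≠ 5`.]" (p. 22): for the prime
`l ≥ 5`, `l ≠ 5` means `l ≥ 7`. [claim: Mochizuki2012, status: disputed] -/
theorem seven_le_l_of_ne_five (X : Thm110Numerics) (h : X.l ≠ 5) : 7 ≤ X.l := by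
  have h5 := X.five_le_l
  have hp := X.prime_l
  by_contra hlt
  have : X.l = 5 ∨ X.l = 6 := by omega
  rcases this with h' | h'
  · exact h h'
  · rw [h'] at hp; exact absurd hp (by decide)

/-! ## The proof data: the printed intermediate inequalities that Steps (i)–(iii), (viii) consume -/

/-- The real numbers that appear only INSIDE the proof of Theorem 1.10 — `log(𝔡^K)`, `log(𝔣^K)` (`K` the
field of the initial Θ-data), `log(𝔰^ℚ)`, `log(𝔰^≤)` (Step (iii), p. 25) — together with the printed
intermediate inequalities about them that the arithmetic Steps (ii), (iii), (viii) take as INPUT. Each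
field quotes the display it stands for and names its printed source; discharging a field = proving that
display from the definitions (other files). [claim: Mochizuki2012, status: disputed] -/
structure ProofData (X : Thm110Numerics) where
  /-- `log(𝔡^K) ∈ ℝ_{≥0}` -/
  logDiffK : ℝ
  /-- as printed -/
  logDiffK_nonneg : 0 ≤ logDiffK
  /-- `log(𝔣^K) ∈ ℝ_{≥0}` -/
  logCondK : ℝ
  /-- as printed -/
  logCondK_nonneg : 0 ≤ logCondK
  /-- `log(𝔰^ℚ) := deg(𝔰^ℚ_ADiv) ∈ ℝ_{≥0}`, `𝔰^ℚ_ADiv = Σ_{v ∈ 𝕍(ℚ)^dst} e_v·v` (Step (iii), p. 25) -/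
  logsQ : ℝ
  /-- as printed -/
  logsQ_nonneg : 0 ≤ logsQ
  /-- `log(𝔰^≤) := deg(𝔰^≤_ADiv) ∈ ℝ_{≥0}`, `𝔰^≤_ADiv = Σ_{w_ℚ ∈ 𝕍(ℚ)^dst} (ι_{w_ℚ}/log(p_{w_ℚ}))·w_ℚ`,
  `ι_{w_ℚ} = 1` if `p_{w_ℚ} ≤ e*_mod·l` and `= 0` otherwise (Step (iii), p. 25) -/
  logsLe : ℝ
  /-- as printed -/
  logsLe_nonneg : 0 ≤ logsLe
  /-- Step (ii), first display (p. 24): "`log(𝔡^{F_tpd}) + log(𝔣^{F_tpd}) ≤ log(𝔡^F) + log(𝔣^F)` follows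
  immediately from Proposition 1.3, (i)". INPUT (source: Prop. 1.3 (i)). -/
  tpd_le_F : X.logDiffTpd + X.logCondTpd ≤ X.logDiffF + X.logCondF
  /-- Step (ii), second display, first inequality (p. 24): "`log(𝔡^F) + log(𝔣^F) ≤ log(𝔡^{F_tpd}) +
  log(𝔣^{F_tpd}) + log(2^11·3^3·5^2)` … by applying Proposition 1.3, (i), at the primes that do not divide
  `2·3·5` [… `F/F_tpd` is tamely ramified over such primes — cf. Proposition 1.8, (vi), (vii)] and applying
  Proposition 1.3, (ii), together with (E3), (E4), (E5), (E6), and … `Gal(F/F_tpd) ↪ GL₂(𝔽₃) × GL₂(𝔽₅) ×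
  ℤ/2ℤ`, at the primes that divide `2·3·5`". INPUT (sources: Props. 1.3, 1.8). -/
  F_le : X.logDiffF + X.logCondF ≤ X.logDiffTpd + X.logCondTpd + Real.log (2 ^ 11 * 3 ^ 3 * 5 ^ 2)
  /-- Step (ii), third display, middle inequality (p. 24): "since the extension `K/F` is tamely ramified
  at the primes that do not divide `l`, and we have a natural outer inclusion `Gal(K/F) ↪ GL₂(𝔽_l)`, the
  inequality `log(𝔡^K) ≤ log(𝔡^K) + log(𝔣^K) ≤ log(𝔡^F) + log(𝔣^F) + 2·log(l)` … follows immediately from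
  Proposition 1.3, (i), (ii)". INPUT (source: Prop. 1.3). -/
  K_le : logDiffK + logCondK ≤ X.logDiffF + X.logCondF + 2 * Real.log X.l
  /-- Step (iii) (p. 26): "it follows immediately from Proposition 1.3, (i), by considering the various
  possibilities for elements `∈ Supp(𝔰^{F_mod}_ADiv)`, that … `log(𝔰^ℚ) ≤ 2·d_mod·(log(𝔡^{F_tpd}) +
  log(𝔣^{F_tpd})) + log(2·3·5·l)`". INPUT (source: Prop. 1.3 (i), conditions (D0)–(D7)). -/
  sQ_le : logsQ ≤ 2 * (X.dmod : ℝ) * (X.logDiffTpd + X.logCondTpd) + Real.log (2 * 3 * 5 * (X.l : ℝ))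
  /-- By the definition of `𝔰^≤_ADiv` (Step (iii), p. 25), `log(𝔰^≤) = #{w_ℚ ∈ 𝕍(ℚ)^dst : p_{w_ℚ} ≤
  e*_mod·l} ≤ Σ_{p ≤ e*_mod·l} 1` (used in Step (viii), p. 30: "`l*_mod·log(𝔰^≤) ≤ log(e*_mod·l)·
  Σ_{p ≤ e*_mod·l} 1`"). INPUT (source: the definition of `𝔰^≤`). -/
  sLe_le : logsLe ≤ (π (X.estar * X.l) : ℝ)
  /-- Steps (iv)–(vii) summed over `v_ℚ ∈ 𝕍_ℚ` (pp. 26–30): the procession-normalized mono-analytic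
  log-volume `−|log(Θ)|` of the holomorphic hull of the union of the possible images of a Θ-pilot object
  (relative to [IUTchIII] Thm 3.11 (i),(ii) with (Ind1), (Ind2), (Ind3)) is bounded above by the sum of
  the local "procession-normalized upper bounds": for `v_ℚ ∈ 𝕍_ℚ^dst` (Step (v), final display, p. 29)
  `(l+1)/4·{(1 + 4/l)·log(𝔡^K_{v_ℚ}) − (1/6)·log(q_{v_ℚ}) + (4/l)·log(𝔰^ℚ_{v_ℚ}) + (20/3)·l*_mod·log(𝔰^≤_{v_ℚ})}`
  [summing to the global `log(𝔡^K)`, `log(q)`, `log(𝔰^ℚ)`, `log(𝔰^≤)`, all supported in `𝕍^dst` by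
  (D1)–(D7)], `0` for `v_ℚ ∈ 𝕍_ℚ^non ∖ 𝕍_ℚ^dst` (Step (vi), p. 29), and `((l⋇+3)/2 =) (l+5)/4·log(π)` at
  the archimedean prime (Step (vii), p. 30). INPUT (sources: Props. 1.2, 1.4 (iii),(iv), 1.5 (iii),(iv),
  1.7, (E1), (E2), (R4); [IUTchIII] Thm 3.11 (i),(ii) — the LOG-VOLUME content of the proof). -/
  hull_le : X.negLogTheta ≤
    ((X.l : ℝ) + 1) / 4 * ((1 + 4 / (X.l : ℝ)) * logDiffK - 1 / 6 * X.logq + 4 / (X.l : ℝ) * logsQ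
      + 20 / 3 * X.lstar * logsLe) + ((X.l : ℝ) + 5) / 4 * Real.log Real.pi

variable {X : Thm110Numerics}

/-! ## Step (ii) (p. 24) -/

/-- Step (ii), second display (p. 24): `log(𝔡^F) + log(𝔣^F) ≤ log(𝔡^{F_tpd}) + log(𝔣^{F_tpd}) + 21`.
[claim: Mochizuki2012, status: disputed] -/
theorem stepii_F_le_tpd_add (P : X.ProofData) :
    X.logDiffF + X.logCondF ≤ X.logDiffTpd + X.logCondTpd + 21 := by
  have := P.F_le; have := log_two_pow_eleven_mul_le; linarith

/-- Step (ii), third display (p. 24): `log(𝔡^K) ≤ log(𝔡^{F_tpd}) + log(𝔣^{F_tpd}) + 2·log(l) + 21`.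
[claim: Mochizuki2012, status: disputed] -/
theorem stepii_K_le_tpd_add (P : X.ProofData) :
    P.logDiffK ≤ X.logDiffTpd + X.logCondTpd + 2 * Real.log X.l + 21 := by
  have := P.K_le; have := stepii_F_le_tpd_add P; have := P.logCondK_nonneg; linarith

/-- Step (ii), final display (p. 24): `(1 + 4/l)·log(𝔡^K) ≤ (1 + 4/l)·(log(𝔡^{F_tpd}) + log(𝔣^{F_tpd}))
+ 2·log(l) + 46` — "where we apply the estimates `log(l)/l ≤ 1/2` and `1 + 4/l ≤ 2`".
[claim: Mochizuki2012, status: disputed] -/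
theorem stepii_final (P : X.ProofData) :
    (1 + 4 / (X.l : ℝ)) * P.logDiffK ≤
      (1 + 4 / (X.l : ℝ)) * (X.logDiffTpd + X.logCondTpd) + 2 * Real.log X.l + 46 := by
  have hl := X.five_le_l_real
  have hl0 : (0 : ℝ) < X.l := by linarith
  have hK := stepii_K_le_tpd_add P
  have hlog0 : 0 ≤ Real.log (X.l : ℝ) := Real.log_nonneg (by linarith)
  have hlogl : Real.log (X.l : ℝ) ≤ X.l / 2 := by
    have := log_div_self_le_half hl0; rwa [div_le_iff₀ hl0, one_div_mul_eq_div] at this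
  have hc : 0 ≤ 1 + 4 / (X.l : ℝ) := by positivity
  have h1 := mul_le_mul_of_nonneg_left hK hc
  -- `(1 + 4/l)·(2 log l + 21) ≤ 2 log l + (8 log l)/l + 42 ≤ 2 log l + 46`
  have h4l : 4 / (X.l : ℝ) ≤ 1 := by rw [div_le_one hl0]; linarith
  have hll : 4 / (X.l : ℝ) * (2 * Real.log X.l) ≤ 4 := by
    have : 4 / (X.l : ℝ) * (2 * Real.log X.l) = 8 * (Real.log X.l / X.l) := by ring
    rw [this]
    have : Real.log (X.l : ℝ) / X.l ≤ 1 / 2 := by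
      rw [div_le_iff₀ hl0]; linarith
    linarith
  have expand : (1 + 4 / (X.l : ℝ)) * (X.logDiffTpd + X.logCondTpd + 2 * Real.log X.l + 21) =
      (1 + 4 / (X.l : ℝ)) * (X.logDiffTpd + X.logCondTpd) + 2 * Real.log X.l
        + 4 / (X.l : ℝ) * (2 * Real.log X.l) + (1 + 4 / (X.l : ℝ)) * 21 := by ring
  rw [expand] at h1
  have : (1 + 4 / (X.l : ℝ)) * 21 ≤ 42 := by nlinarith
  linarith

/-! ## Step (iii) (pp. 25–26) -/

/-- Step (iii) (p. 26): `log(𝔰^ℚ) ≤ 2·d_mod·(log(𝔡^{F_tpd}) + log(𝔣^{F_tpd})) + 5 + log(l)` — "cf. (E6)".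
[claim: Mochizuki2012, status: disputed] -/
theorem stepiii_sQ_le (P : X.ProofData) :
    P.logsQ ≤ 2 * (X.dmod : ℝ) * (X.logDiffTpd + X.logCondTpd) + 5 + Real.log X.l := by
  have hl := X.five_le_l_real
  have := P.sQ_le; have := log_thirty_mul_le (show (0 : ℝ) < X.l by linarith); linarith

/-- Step (iii) (p. 26): `(4/l)·log(𝔰^ℚ) ≤ (8·d_mod/l)·(log(𝔡^{F_tpd}) + log(𝔣^{F_tpd})) + 6` — "cf. (E6); the
fact that `l ≥ 5`". [claim: Mochizuki2012, status: disputed] -/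
theorem stepiii_four_div_l_sQ_le (P : X.ProofData) :
    4 / (X.l : ℝ) * P.logsQ ≤ 8 * (X.dmod : ℝ) / X.l * (X.logDiffTpd + X.logCondTpd) + 6 := by
  have hl := X.five_le_l_real
  have hl0 : (0 : ℝ) < X.l := by linarith
  have hs := stepiii_sQ_le P
  have hc : 0 ≤ 4 / (X.l : ℝ) := by positivity
  have h1 := mul_le_mul_of_nonneg_left hs hc
  have hlogl : Real.log (X.l : ℝ) ≤ X.l / 2 := by
    have := log_div_self_le_half hl0; rwa [div_le_iff₀ hl0, one_div_mul_eq_div] at this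
  have hlog0 : 0 ≤ Real.log (X.l : ℝ) := Real.log_nonneg (by linarith)
  -- `4·(5 + log l)/l = 20/l + 4·log(l)/l ≤ 4 + 2 = 6`
  have e1 : 4 / (X.l : ℝ) * (2 * (X.dmod : ℝ) * (X.logDiffTpd + X.logCondTpd) + 5 + Real.log X.l) =
      8 * (X.dmod : ℝ) / X.l * (X.logDiffTpd + X.logCondTpd) + 20 / X.l + 4 * (Real.log X.l / X.l) := by
    field_simp; ring
  rw [e1] at h1
  have h20 : 20 / (X.l : ℝ) ≤ 4 := by rw [div_le_iff₀ hl0]; linarith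
  have hll : Real.log (X.l : ℝ) / X.l ≤ 1 / 2 := by rw [div_le_iff₀ hl0]; linarith
  linarith

/-- Step (iii), final display (p. 26): "Combining this last inequality with the inequality of the final
display of Step (ii) yields `(1 + 4/l)·log(𝔡^K) + (4/l)·log(𝔰^ℚ) ≤ (1 + 12·d_mod/l)·(log(𝔡^{F_tpd}) +
log(𝔣^{F_tpd})) + 2·log(l) + 52` — where we apply the estimate `d_mod ≥ 1`."
[claim: Mochizuki2012, status: disputed] -/
theorem stepiii_final (P : X.ProofData) :
    (1 + 4 / (X.l : ℝ)) * P.logDiffK + 4 / (X.l : ℝ) * P.logsQ ≤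
      (1 + 12 * (X.dmod : ℝ) / X.l) * (X.logDiffTpd + X.logCondTpd) + 2 * Real.log X.l + 52 := by
  have hl := X.five_le_l_real
  have hl0 : (0 : ℝ) < X.l := by linarith
  have hd : (1 : ℝ) ≤ X.dmod := by exact_mod_cast X.one_le_dmod
  have h1 := stepii_final P
  have h2 := stepiii_four_div_l_sQ_le P
  have hT : 0 ≤ X.logDiffTpd + X.logCondTpd := add_nonneg X.logDiffTpd_nonneg X.logCondTpd_nonneg
  -- `4/l ≤ 4·d_mod/l`
  have h3 : 4 / (X.l : ℝ) * (X.logDiffTpd + X.logCondTpd) ≤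
      4 * (X.dmod : ℝ) / X.l * (X.logDiffTpd + X.logCondTpd) := by
    apply mul_le_mul_of_nonneg_right _ hT
    rw [div_le_div_iff_of_pos_right hl0]; linarith
  have expand1 : (1 + 4 / (X.l : ℝ)) * (X.logDiffTpd + X.logCondTpd) =
      (X.logDiffTpd + X.logCondTpd) + 4 / (X.l : ℝ) * (X.logDiffTpd + X.logCondTpd) := by ring
  have expand2 : (1 + 12 * (X.dmod : ℝ) / X.l) * (X.logDiffTpd + X.logCondTpd) =
      (X.logDiffTpd + X.logCondTpd) + 4 * (X.dmod : ℝ) / X.l * (X.logDiffTpd + X.logCondTpd)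
        + 8 * (X.dmod : ℝ) / X.l * (X.logDiffTpd + X.logCondTpd) := by ring
  rw [expand1] at h1; rw [expand2]
  linarith

end Thm110Numerics

end Literature.IUT.LogVolume

end
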